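import Summits.HubbardSuperconductivity.HubbardLadder.ClusterCutBlocks
import HarnessLib

/-!
# Cluster pair-cuts, piece [C](c), part 2: sparse signed orbit sums and the kernel-decided SPAN check

HONEST FRAMING: ladder R1–R4 with certified numbers; no claim on H/H₀.  Cell pub-hubbard, lane r2-eng-1 (g12); design memo
`pub-hubbard-r2-eng-1/psdcert-g12/C-SPEC-g12.md` §2 / §7 (c2).  Infrastructure; it certifies no cell by itself.

§1 SPARSE INTEGER VECTORS on bitmask keys as association lists sorted by key (`insertSV`, `normalizeSV`) with the evaluation semantics
`evalSV` (sum of the coefficients at a key — meaningful for ANY list, so no invariant is ever assumed in a statement).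
§2 SIGNED ORBIT SUMS: for a list `G` of bitmask maps with signs `(g, ε)` — for the oct12 pieces the 16 maps of D4 × {1, F} with the piece's
sign pattern, `g` acting by `actBits` — `orbitVec G b = normalizeSV [(g·b, ε_g)]`, with `evalSV (orbitVec G b) τ = Σ_{(g,ε) ∈ G, g·b = τ} ε`.
§3 THE SPAN CHECK `spanOK G cols confs`: every configuration `b ∈ confs` has `orbitVec G b` equal to `[]`-evaluating-zero, or to `± col` for a listed
column — decided by the kernel; `spanOK_spec` turns `= true` into the pointwise statement the assembly ([C](d), r2 lineage) consumes together with
the (b)-side interface lemma «8•P_t e_c = orbitSum t c».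
The bit semantics of `actBits` (a permutation table + optional global flip) is recorded as `testBit_actBits` for part 3.  All statements [folklore].

FILE SPLIT (400-line rule; FILER lit g35, bodies byte-identical to the staged `psdcert-g12/lean-staged/ClusterCutFrames.lean`
97861d910070da5c, 425 l.): THIS file = §1 sparse integer vectors + §2 signed orbit sums + §3 the SPAN check; `ClusterCutFrames.lean`
(imports this file) = §4 the block-entry builder + §5 row checks + §6 the fast `Xint` row.
-/

namespace Summit.HubbardSuperconductivity.HubbardLadder.ClusterCut

/-! ## §1 Sparse integer vectors keyed by naturals -/

/-- Sparse vector = association list `(key, coefficient)`; intended sorted by key without duplicates, but every statement below is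
about `evalSV`, which is meaningful for any list. -/
abbrev SVec := List (ℕ × ℤ)

/-- Evaluation at a key: the sum of all coefficients carrying that key. [folklore] -/
def evalSV : SVec → ℕ → ℤ
  | [], _ => 0
  | (k, c) :: v, q => (if k = q then c else 0) + evalSV v q

/-- Insert `(k, c)` keeping keys sorted and merged (drops an entry whose merged coefficient is `0`). [folklore] -/
def insertSV (k : ℕ) (c : ℤ) : SVec → SVec
  | [] => if c = 0 then [] else [(k, c)]
  | (k', c') :: v =>
    if k < k' then (if c = 0 then (k', c') :: v else (k, c) :: (k', c') :: v)
    else if k = k' then (if c + c' = 0 then v else (k, c + c') :: v)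
    else (k', c') :: insertSV k c v

/-- Normal form of an arbitrary association list (sorted, merged, zero-free). [folklore] -/
def normalizeSV : SVec → SVec
  | [] => []
  | (k, c) :: v => insertSV k c (normalizeSV v)

/-- Negation of a sparse vector. [folklore] -/
def negSV (v : SVec) : SVec := v.map fun e => (e.1, -e.2)

/-- `evalSV` of an insertion: the inserted coefficient is added at its key. [folklore] -/
theorem evalSV_insertSV (k : ℕ) (c : ℤ) (v : SVec) (q : ℕ) :
    evalSV (insertSV k c v) q = (if k = q then c else 0) + evalSV v q := by
  induction v with
  | nil =>
    unfold insertSV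
    by_cases h : c = 0
    · rw [if_pos h]; simp [evalSV, h]
    · rw [if_neg h]; simp [evalSV]
  | cons e v ih =>
    obtain ⟨k', c'⟩ := e
    unfold insertSV
    by_cases h1 : k < k'
    · rw [if_pos h1]
      by_cases h0 : c = 0
      · rw [if_pos h0]; simp [evalSV, h0]
      · rw [if_neg h0]; simp [evalSV]
    · rw [if_neg h1]
      by_cases h2 : k = k'
      · subst h2
        rw [if_pos rfl]
        by_cases h0 : c + c' = 0
        · rw [if_pos h0]
          simp only [evalSV]
          by_cases hq : k = q
          · rw [if_pos hq, if_pos hq]; linarith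
          · rw [if_neg hq, if_neg hq]; ring
        · rw [if_neg h0]
          simp only [evalSV]
          by_cases hq : k = q
          · rw [if_pos hq, if_pos hq, if_pos hq]; ring
          · rw [if_neg hq, if_neg hq, if_neg hq]; ring
      · rw [if_neg h2]
        simp only [evalSV, ih]
        ring

/-- `normalizeSV` preserves evaluation. [folklore] -/
theorem evalSV_normalizeSV (v : SVec) (q : ℕ) : evalSV (normalizeSV v) q = evalSV v q := by
  induction v with
  | nil => rfl
  | cons e v ih =>
    obtain ⟨k, c⟩ := e
    simp only [normalizeSV, evalSV_insertSV, ih, evalSV]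

/-- `negSV` negates evaluation. [folklore] -/
theorem evalSV_negSV (v : SVec) (q : ℕ) : evalSV (negSV v) q = -evalSV v q := by
  induction v with
  | nil => simp [negSV, evalSV]
  | cons e v ih =>
    obtain ⟨k, c⟩ := e
    simp only [negSV, List.map_cons, evalSV] at ih ⊢
    rw [ih]
    split_ifs <;> ring

/-- Evaluation of an appended list. [folklore] -/
theorem evalSV_append (u v : SVec) (q : ℕ) : evalSV (u ++ v) q = evalSV u q + evalSV v q := by
  induction u with
  | nil => simp [evalSV]
  | cons e u ih =>
    obtain ⟨k, c⟩ := e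
    simp only [List.cons_append, evalSV, ih]
    ring

/-! ## §2 Bitmask maps and signed orbit sums -/

/-- A bitmask map: an image table `perm` (site `i ↦ perm[i]`) applied to the set bits of `b` among the first `N`, then an optional global flip
of the first `N` bits.  (For the oct12 pieces: the 8 site permutations of D4 × {no flip, flip}.) [folklore] -/
def actBits (N : ℕ) (perm : List ℕ) (flip : Bool) (b : ℕ) : ℕ :=
  let moved := (List.range N).foldl (fun acc i => if b.testBit i then acc ||| 2 ^ (perm.getD i i) else acc) 0
  if flip then (2 ^ N - 1) ^^^ moved else moved

/-- Signed orbit sum of the configuration `b` under the listed maps: the sparse vector `Σ_{(perm, flip, ε)} ε · e_{act b}`. [folklore] -/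
def orbitVec (N : ℕ) (G : List (List ℕ × Bool × ℤ)) (b : ℕ) : SVec :=
  normalizeSV (G.map fun g => (actBits N g.1 g.2.1 b, g.2.2))

/-- The raw (un-normalised) term list of an orbit sum evaluates to the signed count of maps sending `b` to `τ`. [folklore] -/
theorem evalSV_map_terms (N : ℕ) (G : List (List ℕ × Bool × ℤ)) (b τ : ℕ) :
    evalSV (G.map fun g => (actBits N g.1 g.2.1 b, g.2.2)) τ =
      (G.map fun g => if actBits N g.1 g.2.1 b = τ then g.2.2 else 0).sum := by
  induction G with
  | nil => rfl
  | cons g G ih => simp only [List.map_cons, evalSV, ih, List.sum_cons]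

/-- **Semantics of `orbitVec`**: `evalSV (orbitVec N G b) τ = Σ_{(g, ε) ∈ G, g·b = τ} ε`. [folklore] -/
theorem evalSV_orbitVec (N : ℕ) (G : List (List ℕ × Bool × ℤ)) (b τ : ℕ) :
    evalSV (orbitVec N G b) τ = (G.map fun g => if actBits N g.1 g.2.1 b = τ then g.2.2 else 0).sum := by
  rw [orbitVec, evalSV_normalizeSV, evalSV_map_terms]

/-! ## §3 The SPAN check -/

/-- `v` evaluates like `w` or like `−w` or like `0`, tested on normal forms (list equality). [folklore] -/
def matchesCol (v : SVec) (cols : List SVec) : Bool :=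
  decide (v = []) || cols.any fun w => decide (v = w) || decide (v = negSV w)

/-- **The span check**: every listed configuration's signed orbit sum is `0` or `± a listed column`. [folklore] -/
def spanOK (N : ℕ) (G : List (List ℕ × Bool × ℤ)) (cols : List SVec) (confs : List ℕ) : Bool :=
  confs.all fun b => matchesCol (orbitVec N G b) cols

/-- **Semantics of the span check**: for every listed configuration `b`, the signed orbit sum `τ ↦ Σ_{g·b = τ} ε_g` is identically `0`,
or equals `± evalSV col` for some listed column. [folklore] -/
theorem spanOK_spec {N : ℕ} {G : List (List ℕ × Bool × ℤ)} {cols : List SVec} {confs : List ℕ}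
    (h : spanOK N G cols confs = true) {b : ℕ} (hb : b ∈ confs) :
    (∀ τ, evalSV (orbitVec N G b) τ = 0) ∨
      ∃ col ∈ cols, (∀ τ, evalSV (orbitVec N G b) τ = evalSV col τ) ∨ (∀ τ, evalSV (orbitVec N G b) τ = -evalSV col τ) := by
  simp only [spanOK, List.all_eq_true] at h
  have hm := h b hb
  simp only [matchesCol, Bool.or_eq_true, decide_eq_true_eq, List.any_eq_true] at hm
  rcases hm with h0 | ⟨w, hw, hvw⟩
  · left; intro τ; rw [h0]; rfl
  · right
    refine ⟨w, hw, ?_⟩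
    rcases hvw with h1 | h2
    · left; intro τ; rw [h1]
    · right; intro τ; rw [h2, evalSV_negSV]

end Summit.HubbardSuperconductivity.HubbardLadder.ClusterCut
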